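import Mathlib.LinearAlgebra.Span.Basic
import Mathlib.Data.Int.Basic
import HarnessLib

/-!
# Genus-one folds: a Hurwitz move preserves the shadow lattice (helper for Stub D)

Helper file (worker D of lead a4, line `folded-curve-branch-locus` of the crux
`ConvexBisection.AcyclicBisectionRigidity`, item stmt-SmoothPoincare4-10507, stub
`stub_genusOneFold`).  On the one-holed torus `F_{1,1}` a signed Hurwitz move replaces a pair of
vanishing cycles `(u, v)` by `(T_u v, u)` with `T_u v = v + (u × v) u` the Picard–Lefschetz
transvection (`u × v = u₀ v₁ − u₁ v₀` the intersection form on `H₁(F_{1,1}; ℤ) = ℤ²`, tree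
convention of `SignedHurwitz.transvection` / `stdSymp`).  The lattice `ℤ u + ℤ v ⊆ ℤ²` spanned by
the two shadows — whose index `|u × v|` is the order of `π₁` of the genus-one Lefschetz
handlebody `X(F_{1,1}; u, v)` and whose sum with the other hemisphere's lattice decides simple
connectivity of the fold (the "transverse" condition of the census
`work/census/genus1_census.md`) — is therefore invariant under one-sided Hurwitz moves.  This is
the algebraic half of dictionary item (iii) of the Stub-D brief; it is elementary and Mathlib-only.

* `helper_transvection_hurwitz_span` — `span ℤ {v + (u 0 * v 1 - u 1 * v 0) • u, u} = span ℤ {u, v}`.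

Everything is proved; no definitions, no named facts. [folklore]
-/

-- the prescribed namespace `Summit.<P>.<Sub>.…` duplicates `SmoothPoincare4` (P = Sub)
set_option linter.dupNamespace false

namespace Summit.SmoothPoincare4.SmoothPoincare4.Theorems.AcyclicBisectionRigidity.FoldedCurveBranchLocus

/-- **A Hurwitz move preserves the shadow lattice (genus one).**  For any `u v : ℤ²` the pair
`(T_u v, u)`, `T_u v = v + (u × v) • u`, spans the same sublattice of `ℤ²` as `(u, v)`: both
inclusions are two-line membership checks (`T_u v − (u × v) • u = v`).  Used by the genus-one fold
census of Stub D (the index `|u × v|` of the hemisphere lattice is a Hurwitz invariant, so for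
`|u × v| ≥ 2` Hurwitz-equivalent hemispheres never give a simply connected fold). [folklore] -/
theorem helper_transvection_hurwitz_span :
    ∀ u v : Fin 2 → ℤ,
      Submodule.span ℤ ({v + (u 0 * v 1 - u 1 * v 0) • u, u} : Set (Fin 2 → ℤ)) =
        Submodule.span ℤ {u, v} := by
  intro u v
  apply le_antisymm
  · rw [Submodule.span_le]
    rintro x (rfl | hx)
    · exact Submodule.add_mem _ (Submodule.subset_span (by simp))
        (Submodule.smul_mem _ _ (Submodule.subset_span (by simp)))
    · rw [Set.mem_singleton_iff] at hx
      subst hx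
      exact Submodule.subset_span (by simp)
  · rw [Submodule.span_le]
    rintro x (rfl | hx)
    · exact Submodule.subset_span (by simp)
    · rw [Set.mem_singleton_iff] at hx
      subst hx
      have h1 : x + (u 0 * x 1 - u 1 * x 0) • u ∈
          Submodule.span ℤ ({x + (u 0 * x 1 - u 1 * x 0) • u, u} : Set (Fin 2 → ℤ)) :=
        Submodule.subset_span (by simp)
      have h2 : u ∈ Submodule.span ℤ ({x + (u 0 * x 1 - u 1 * x 0) • u, u} : Set (Fin 2 → ℤ)) :=
        Submodule.subset_span (by simp)
      have h3 := Submodule.sub_mem _ h1 (Submodule.smul_mem _ (u 0 * x 1 - u 1 * x 0) h2)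
      simpa using h3

end Summit.SmoothPoincare4.SmoothPoincare4.Theorems.AcyclicBisectionRigidity.FoldedCurveBranchLocus
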